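import Summits.QuantumFields.YangMills.Theorems.UnitScaleTiltProp7QTwSCentralTowerRows
import Summits.QuantumFields.YangMills.Theorems.UnitScaleTiltProp8ChartCovariance
import Literature.MathematicalPhysics.QuantumFieldTheory.Balaban1983to89.LatticeWordStokes
import HarnessLib

/-!
# Route `UnitScaleTilt`, crux K1 child «MinimiserStabilityRegPr» (stmt-QuantumFields-19200), skeleton v10, stub `stub_existenceMinimalOrbit` (EX), route (α) —
# **THE TOWER-CLOSENESS ROWS OF T5 FROM `RegPr`, PART 1∕2: STAIR LETTERS AND THE ROW `hτ`.**  The six displayed hypotheses `hτ hν hν' hw hH hH'` of ★w5-20520 g6's T5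
# (✓`Prop7FrameLevelOnto.exists_frameCorrected_eq` ∕ `Prop7TwistedSliceGaugeOntoTower.exists_slice_tangent_add_gaugeDir_of_QSym_eq_zero_of_tower`) are supplied at a
# printed-regular background `U₀ ∈ 𝔘_k(ε₀)` and the chart point `U′ = e^{A₁}U₀`, `‖A₁‖ < e·η`, under the T5 windows `10¹²L³ε₀ ≤ 1`, `10⁹L²e ≤ 1` ONLY (no regularity of `U′`);
# this file: the word∕holonomy letters and `hτ`; the sibling `…TowerClosenessOfRegPr`: the frames (`hν hν' hw`) and the loops (`hH hH'`).

Cell `ym3-torus`, width seat `ym3-torus-px6` (gen 0).  THEOREMS ONLY (0 `def`, 0 `sorry`).  `--supports stmt-QuantumFields-19200 --as helper`, count-neutral.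
YM₃ on T³ is a ladder rung (R3), not the Clay problem; nothing here claims the stub, the crux, d = 4 or the mass gap.

WHAT IS PROVED (sorry-free, no definition).
* §1 (generic) word bookkeeping: `disp_apply_eq_netDisp'`, `walkEnd_eq_transl_disp'`, `walkEnd_stairWord_eq` ∕ `disp_stairWord_eq` (two staircases with the same offsets end at the
  same site), `off_centre_eq_zero` ∕ `stairWord_off_centre` (the reference staircase to the block centre is the EMPTY word); `norm_conj_triple_sub_one_le`
  (`‖ν(τGτ′⁻¹)ν⁻¹ − 1‖ ≤ 4a + 2c` for `ν, G ∈ U1`, `‖τ − 1‖, ‖τ′ − 1‖ ≤ a ≤ ½`, `‖G − 1‖ ≤ c`); ★`dist1_holT_stair_mul_inv_stair_le` — **the two-staircase non-abelian Stokes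
  bound**: for a `GaugeGroup`-valued field with plaquette variables within `δ` of `1`, `dist1 (V(Γ_σ)·V(Γ_τ)⁻¹) ≤ (d·N)²·δ` for the staircases `Γ_σ, Γ_τ ∈ G(x, x + n)` of two axis
  orders (`|n_ν| ≤ N`): the closed word `Γ_σ ∪ (−Γ_τ)` has length `≤ 2dN` and zero net displacement, so ✓`LatticeWordStokes.dist1_holAt_le` applies.
* §2 (generic normed algebra) `frame_holT_dbarCovIterU_frame_inv_eq` — the framed transporter of the covariant tower is the transporter of the plain average:
  `ν_j(x)·D̄_j(Γ_{x,·})·ν_j(x + disp Γ)⁻¹ = Ū′⁽ʲ⁾(Γ)` for EVERY word `Γ` (`D̄_j = (Ū′⁽ʲ⁾)^{ν_j⁻¹}`, ✓`dbarCovIterU_eq_gaugeActT_frameAccU` + ✓`holT_gaugeActT`), i.e. T5's `Q_{y,i}` IS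
  `Ū′⁽ʲ⁾(Γ_{y,i})`; `holT_unitsField_toUField_eq_map` ∕ `coe_map_eq` (units-level reading of `SU(2)` transports through `ι : SU(2) → U(2) → (M₂)ˣ`).
* §3 (T³ member, `d = 3`): `bgUnits_eq_expUnit_mul` (`U′♭ = e^{A₁}U₀♭`), `coe_expUnit_mem_specialUnitaryGroup_of_chart` (`e^{A₁(b)} = U′(b)U₀(b)⁻¹ ∈ SU(2)`), `window7_of_window12`;
  ★★`norm_tstairU_sub_one_le_of_regPr` — `‖τ_j(y,i) − 1‖ ≤ 10⁻⁶` index by index for the twisted stair transporters `τ_j(y,i) = tstairU (Ū₀♭ʲ) (D̄_j) y i` of the covariant tower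
  `D̄_j = dbarCovIterU j U₀♭ U′♭` against the background tower, `j < K − n` (relative closeness `3(2e + 2700Lε₀)` of the towers ✓`norm_dbarCovIterU_rel_sub_one_le_of_regPr`, the
  `U1`-valued background tower, ✓`norm_tstairU_sub_one_le_of_rel`; `120·Le + 162000·L²ε₀ ≤ 2.82·10⁻⁷`) ⇒ **ROW `hτ`** ★★`norm_tstairU_tower_sub_one_le_of_regPr` (sup norm `≤ 1∕200`).
HONEST SCOPE.  Compositions of landed letters with explicit numerals; the rows are exactly T5's displayed hypotheses (T5 A∕B are ★w5-20520 g6's files and are NOT imported here);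
nothing of [Balaban1985Averaging] ∕ [Balaban1985Variational] is asserted beyond the cited bookkeeping.

References: T. Bałaban, CMP **98** (1985) 17–51 [Balaban1985Averaging] ((8)–(9), (11) pp.18–19, (19)–(20) p.21, (58) p.27, (82) p.30, (89) p.31, (97) p.32, (161)–(163) p.42);
CMP **102** (1985) 277–309 [Balaban1985Variational] ((2) p.278, (44) p.285, (112) p.295, (146) p.301); CMP **109** (1987) 249–301 [Balaban1987RG1] ((0.3)–(0.4) pp.252–253, (0.11) p.253).
-/

set_option autoImplicit false

noncomputable section

open scoped Matrix.Norms.L2Operator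
open Filter Topology Metric

namespace Summit.QuantumFields.YangMills.Theorems.Prop7TowerClosenessOfRegPr

open NormedSpace
open Literature.MathematicalPhysics.QuantumFieldTheory.Balaban1983to89
open T4Continuum T4ReflectionCone BlockAveraging AveragingRT ExpMeanLog MatrixLog LatticeFieldCalculus
open LatticeWordStokes (dist1_holAt_le length_stairWord_le)
open FederbushMean (dist1_SU_eq)
open B10Eq27TorusAxialLog (holT holT_nil holT_cons_true holT_cons_false holT_append holT_map holT_eq_holAt gaugeActT gaugeActT_apply transl transl_apply
  unitsField toUField suIncl val_suIncl)
open B7Prop1Explicit (expUnit val_expUnit U1 mem_U1 disp disp_nil disp_cons)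
open B7Prop2SpecialUnitary (specialUnitaryUnits mem_specialUnitaryUnits specialUnitaryUnits_le_U1)
open T3ContinuumYM3Torus
open T3RegularMinimiser (regThreshold)
open T3PrintedRegularMinimiser (RegPr)
open T3SectALandauChart (eta eta_pos bgUnits)
open Summit.QuantumFields.YangMills.Theorems.Prop8Chart (emlIterU emlIterU_succ holT_gaugeActT)
open Summit.QuantumFields.YangMills.Theorems.Prop7SymAvgTwSym (tstairU tstairU_def vframeCovU dbarCovIterU frameAccU frameAccU_succ dbarCovIterU_eq_gaugeActT_frameAccU
  norm_tstairU_sub_one_le_of_rel norm_sub_le_of_rel norm_inv_sub_inv_le_of_rel emlIterU_bgUnits_mem_U1_of_regPr norm_dbarCovIterU_rel_sub_one_le_of_regPr)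
open Summit.QuantumFields.YangMills.Theorems.Prop7SymAvgGLSmallOfRegPr (coe_iter_eq_emlIterU_of_regPr bgUnits_eq)
open Summit.QuantumFields.YangMills.Theorems.IterPlaqSmallAllL (plaqSmall_iter_T3_allL)

/-! ## §1 Word bookkeeping and the two-staircase Stokes bound -/

section Words

variable {P : Params} {j : ℕ}

/-- The coordinates of B7's displacement vector are the tree's net displacements (local copy of ✓`Prop7AxialGaugeFace.disp_apply_eq_netDisp`). [folklore] -/
theorem disp_apply_eq_netDisp' {d : ℕ} : ∀ (w : List (B7Prop1Explicit.Letter d)) (ν : Fin d), disp w ν = netDisp w ν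
  | [], ν => by simp [netDisp]
  | (μ, b) :: w, ν => by
    rw [disp_cons, netDisp_cons, Pi.add_apply, disp_apply_eq_netDisp' w ν]
    cases b <;> by_cases h : μ = ν <;> simp [B7Prop1Explicit.Letter.vec, B7Prop1Explicit.e_apply, h, eq_comm]

/-- The end of the walk spelled by `w` from `y` is `y + disp w` (local copy of ✓`HalvingP1FlatCoreTopCubeWalks.walkEnd_eq_transl_disp`).
[cite: Balaban1985Averaging, (9) p.18] -/
theorem walkEnd_eq_transl_disp' (y : Site P j) (w : List (B7Prop1Explicit.Letter P.d)) : walkEnd y w = transl y (disp w) := by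
  funext ν
  rw [walkEnd_apply, transl_apply, disp_apply_eq_netDisp']

/-- Two staircases with the same offsets end at the same site. [cite: Balaban1987RG1, (0.3) p.252] -/
theorem walkEnd_stairWord_eq (x : Site P j) (σ τ : Equiv.Perm (Fin P.d)) (n : Fin P.d → ℤ) :
    walkEnd x (stairWord σ n) = walkEnd x (stairWord τ n) := by
  funext ν
  rw [walkEnd_apply, walkEnd_apply, netDisp_stairWord, netDisp_stairWord]

/-- Two staircases with the same offsets have the same displacement vector. [cite: Balaban1987RG1, (0.3) p.252] -/
theorem disp_stairWord_eq {d : ℕ} (σ τ : Equiv.Perm (Fin d)) (n : Fin d → ℤ) : disp (stairWord σ n) = disp (stairWord τ n) := by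
  funext ν
  rw [disp_apply_eq_netDisp', disp_apply_eq_netDisp', netDisp_stairWord, netDisp_stairWord]

/-- The centre index has zero centred offset: `off (r_c, …, r_c) = 0`, `r_c = (L − 1)∕2`. [cite: Balaban1987RG1, (0.3) p.252] -/
theorem off_centre_eq_zero (h : (P.L - 1) / 2 < P.L) : off (P := P) (fun _ : Fin P.d => (⟨(P.L - 1) / 2, h⟩ : Fin P.L)) = 0 := by
  funext ν
  simp [off]

/-- The reference staircase to the block centre is the empty word. [cite: Balaban1987RG1, (0.3) p.252] -/
theorem stairWord_off_centre (σ : Equiv.Perm (Fin P.d)) (h : (P.L - 1) / 2 < P.L) :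
    stairWord σ (off (P := P) (fun _ : Fin P.d => (⟨(P.L - 1) / 2, h⟩ : Fin P.L))) = [] := by
  rw [off_centre_eq_zero]
  -- the staircase of the zero offset is the empty word (cf. ✓`QLaBlockAvgLinear.stairWord_zero` on the T⁴ side)
  have hruns : ∀ l : List (Fin P.d), stairRuns (0 : Fin P.d → ℤ) l = [] := by
    intro l
    induction l with
    | nil => rfl
    | cons a l ih => rw [stairRuns, ih]; simp [axisRun]
  exact hruns _

section Conj

variable {𝔸 : Type*} [NormedRing 𝔸] [NormOneClass 𝔸]

/-- **A CONJUGATED NEAR-IDENTITY TRIPLE**: for units `ν, G ∈ U1` (`‖·‖, ‖·⁻¹‖ ≤ 1`), `‖τ − 1‖, ‖τ′ − 1‖ ≤ a ≤ ½` and `‖G − 1‖ ≤ c`: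
`‖ν·(τ·G·τ′⁻¹)·ν⁻¹ − 1‖ ≤ 4a + 2c` (`‖τ′⁻¹ − 1‖ ≤ 2a` by ✓`norm_units_inv_sub_one_le`; `X − 1 = (τ−1)Gτ′⁻¹ + (G−1)τ′⁻¹ + (τ′⁻¹−1)`). [cite: Balaban1985Averaging, (19)-(20) p.21] -/
theorem norm_conj_triple_sub_one_le {ν G τ τ' : 𝔸ˣ} {a c : ℝ} (hν : ν ∈ U1 𝔸) (hG : G ∈ U1 𝔸) (hτ : ‖(τ : 𝔸) - 1‖ ≤ a) (hτ' : ‖(τ' : 𝔸) - 1‖ ≤ a)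
    (ha : a ≤ 1 / 2) (hc : ‖(G : 𝔸) - 1‖ ≤ c) :
    ‖((ν * (τ * G * τ'⁻¹) * ν⁻¹ : 𝔸ˣ) : 𝔸) - 1‖ ≤ 4 * a + 2 * c := by
  have ha0 : 0 ≤ a := (norm_nonneg _).trans hτ
  have hc0 : 0 ≤ c := (norm_nonneg _).trans hc
  have hinv : ‖((τ'⁻¹ : 𝔸ˣ) : 𝔸) - 1‖ ≤ 2 * a := (B7Prop6Flat.norm_units_inv_sub_one_le τ' (hτ'.trans ha)).trans (by linarith)
  have hinv' : ‖((τ'⁻¹ : 𝔸ˣ) : 𝔸)‖ ≤ 2 := by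
    have h1 : ‖((τ'⁻¹ : 𝔸ˣ) : 𝔸)‖ ≤ ‖(1 : 𝔸)‖ + ‖((τ'⁻¹ : 𝔸ˣ) : 𝔸) - 1‖ := by
      calc ‖((τ'⁻¹ : 𝔸ˣ) : 𝔸)‖ = ‖(1 : 𝔸) + (((τ'⁻¹ : 𝔸ˣ) : 𝔸) - 1)‖ := by congr 1; abel
        _ ≤ ‖(1 : 𝔸)‖ + ‖((τ'⁻¹ : 𝔸ˣ) : 𝔸) - 1‖ := norm_add_le _ _
    rw [norm_one] at h1
    linarith
  have hGn : ‖(G : 𝔸)‖ ≤ 1 := (mem_U1.1 hG).1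
  -- the inner triple
  set X : 𝔸 := (τ : 𝔸) * (G : 𝔸) * ((τ'⁻¹ : 𝔸ˣ) : 𝔸) with hX
  have hXid : X - 1 = ((τ : 𝔸) - 1) * (G : 𝔸) * ((τ'⁻¹ : 𝔸ˣ) : 𝔸) + ((G : 𝔸) - 1) * ((τ'⁻¹ : 𝔸ˣ) : 𝔸) + (((τ'⁻¹ : 𝔸ˣ) : 𝔸) - 1) := by
    rw [hX]; noncomm_ring
  have hX1 : ‖X - 1‖ ≤ 4 * a + 2 * c := by
    rw [hXid]
    have h1 : ‖((τ : 𝔸) - 1) * (G : 𝔸) * ((τ'⁻¹ : 𝔸ˣ) : 𝔸)‖ ≤ a * 1 * 2 := by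
      calc ‖((τ : 𝔸) - 1) * (G : 𝔸) * ((τ'⁻¹ : 𝔸ˣ) : 𝔸)‖ ≤ ‖((τ : 𝔸) - 1) * (G : 𝔸)‖ * ‖((τ'⁻¹ : 𝔸ˣ) : 𝔸)‖ := norm_mul_le _ _
        _ ≤ (‖(τ : 𝔸) - 1‖ * ‖(G : 𝔸)‖) * ‖((τ'⁻¹ : 𝔸ˣ) : 𝔸)‖ := mul_le_mul_of_nonneg_right (norm_mul_le _ _) (norm_nonneg _)
        _ ≤ a * 1 * 2 := by
          apply mul_le_mul (mul_le_mul hτ hGn (norm_nonneg _) ha0) hinv' (norm_nonneg _) (by positivity)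
    have h2 : ‖((G : 𝔸) - 1) * ((τ'⁻¹ : 𝔸ˣ) : 𝔸)‖ ≤ c * 2 :=
      (norm_mul_le _ _).trans (mul_le_mul hc hinv' (norm_nonneg _) hc0)
    calc ‖((τ : 𝔸) - 1) * (G : 𝔸) * ((τ'⁻¹ : 𝔸ˣ) : 𝔸) + ((G : 𝔸) - 1) * ((τ'⁻¹ : 𝔸ˣ) : 𝔸) + (((τ'⁻¹ : 𝔸ˣ) : 𝔸) - 1)‖
        ≤ ‖((τ : 𝔸) - 1) * (G : 𝔸) * ((τ'⁻¹ : 𝔸ˣ) : 𝔸) + ((G : 𝔸) - 1) * ((τ'⁻¹ : 𝔸ˣ) : 𝔸)‖ + ‖((τ'⁻¹ : 𝔸ˣ) : 𝔸) - 1‖ := norm_add_le _ _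
      _ ≤ (‖((τ : 𝔸) - 1) * (G : 𝔸) * ((τ'⁻¹ : 𝔸ˣ) : 𝔸)‖ + ‖((G : 𝔸) - 1) * ((τ'⁻¹ : 𝔸ˣ) : 𝔸)‖) + ‖((τ'⁻¹ : 𝔸ˣ) : 𝔸) - 1‖ :=
          add_le_add (norm_add_le _ _) le_rfl
      _ ≤ (a * 1 * 2 + c * 2) + 2 * a := add_le_add (add_le_add h1 h2) hinv
      _ = 4 * a + 2 * c := by ring
  -- conjugation by `ν ∈ U1`
  have hconj : ((ν * (τ * G * τ'⁻¹) * ν⁻¹ : 𝔸ˣ) : 𝔸) - 1 = (ν : 𝔸) * (X - 1) * ((ν⁻¹ : 𝔸ˣ) : 𝔸) := by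
    rw [hX, mul_sub, sub_mul, mul_one, Units.mul_inv]
    simp only [Units.val_mul]
  rw [hconj]
  calc ‖(ν : 𝔸) * (X - 1) * ((ν⁻¹ : 𝔸ˣ) : 𝔸)‖ ≤ ‖(ν : 𝔸) * (X - 1)‖ * ‖((ν⁻¹ : 𝔸ˣ) : 𝔸)‖ := norm_mul_le _ _
    _ ≤ (‖(ν : 𝔸)‖ * ‖X - 1‖) * ‖((ν⁻¹ : 𝔸ˣ) : 𝔸)‖ := mul_le_mul_of_nonneg_right (norm_mul_le _ _) (norm_nonneg _)
    _ ≤ (1 * (4 * a + 2 * c)) * 1 := by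
        apply mul_le_mul (mul_le_mul (mem_U1.1 hν).1 hX1 (norm_nonneg _) zero_le_one) (mem_U1.1 hν).2 (norm_nonneg _) (by positivity)
    _ = 4 * a + 2 * c := by ring

end Conj

variable {G : Type*} [GaugeGroup G]

/-- ★ **THE TWO-STAIRCASE NON-ABELIAN STOKES BOUND**: if every plaquette variable of `V` is within `δ ≥ 0` of `1`, then for the two staircases `Γ_σ, Γ_τ` from `x` to
`x + n` (axis orders `σ, τ`, offsets `|n_ν| ≤ N`) `dist1 (V(Γ_σ)·V(Γ_τ)⁻¹) ≤ (d·N)²·δ` — the closed word `Γ_σ ∪ (−Γ_τ)` has zero net displacement and length `≤ 2dN`, and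
✓`LatticeWordStokes.dist1_holAt_le` bounds every such holonomy by `(|w|²∕4)·δ`. [cite: Balaban1985Averaging, (19)-(20) p.21; Balaban1987RG1, (0.3)-(0.4) pp.252-253] -/
theorem dist1_holT_stair_mul_inv_stair_le {δ : ℝ} (hδ : 0 ≤ δ) (V : GaugeField P j G) (hV : PlaqSmall δ V) (x : Site P j)
    (σ τ : Equiv.Perm (Fin P.d)) (n : Fin P.d → ℤ) {N : ℕ} (hn : ∀ ν, (n ν).natAbs ≤ N) :
    dist1 (holT V x (stairWord σ n) * (holT V x (stairWord τ n))⁻¹) ≤ ((P.d : ℝ) * N) ^ 2 * δ := by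
  have hclosed : ∀ ν, netDisp (stairWord σ n ++ wordRev (stairWord τ n)) ν = 0 := by
    intro ν; rw [netDisp_append, netDisp_wordRev, netDisp_stairWord, netDisp_stairWord, add_neg_cancel]
  have hprod : holT V x (stairWord σ n) * (holT V x (stairWord τ n))⁻¹ = holAt V (walk x (stairWord σ n ++ wordRev (stairWord τ n))) := by
    rw [holT_eq_holAt, holT_eq_holAt, walk_append, holAt_append, walkEnd_stairWord_eq x σ τ n, holAt_walk_wordRev]
  rw [hprod]
  refine (dist1_holAt_le V hδ hV _ hclosed x).trans ?_
  have hlen : ((stairWord σ n ++ wordRev (stairWord τ n)).length : ℝ) ≤ 2 * ((P.d : ℝ) * N) := by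
    have h₁ := length_stairWord_le σ n N hn
    have h₂ := length_stairWord_le τ n N hn
    rw [List.length_append, show (wordRev (stairWord τ n)).length = (stairWord τ n).length by simp [wordRev]]
    push_cast
    have h₁' : ((stairWord σ n).length : ℝ) ≤ (P.d : ℝ) * N := by exact_mod_cast h₁
    have h₂' : ((stairWord τ n).length : ℝ) ≤ (P.d : ℝ) * N := by exact_mod_cast h₂
    linarith
  have h0 : (0 : ℝ) ≤ ((stairWord σ n ++ wordRev (stairWord τ n)).length : ℝ) := Nat.cast_nonneg _
  have hsq : ((stairWord σ n ++ wordRev (stairWord τ n)).length : ℝ) ^ 2 / 4 ≤ ((P.d : ℝ) * N) ^ 2 := by nlinarith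
  exact mul_le_mul_of_nonneg_right hsq hδ

end Words

/-! ## §2 The framed transporters of the covariant tower are the transporters of the plain average -/

section Framed

variable {P : Params} {𝔸 : Type*} [NormedRing 𝔸] [NormedAlgebra ℂ 𝔸] [CompleteSpace 𝔸]

/-- ★ **`ν_j(x)·D̄_j(Γ)·ν_j(x + disp Γ)⁻¹ = Ū′⁽ʲ⁾(Γ)`** for every word `Γ` from `x`: the covariant double-bar tower is the plain average in the accumulated frames
(✓`dbarCovIterU_eq_gaugeActT_frameAccU`: `D̄_j = (Ū′⁽ʲ⁾)^{ν_j⁻¹}`), and transports of a gauge-transformed field conjugate by the gauge at the two ends (✓`holT_gaugeActT`).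
[cite: Balaban1985Averaging, (8)-(9) pp.18-19, (97) p.32] -/
theorem frame_holT_dbarCovIterU_frame_inv_eq (j : ℕ) (V W : GaugeField P 0 𝔸ˣ) (x : Site P j) (w : List (B7Prop1Explicit.Letter P.d)) :
    frameAccU j V W x * holT (dbarCovIterU j V W) x w * (frameAccU j V W (transl x (disp w)))⁻¹ = holT (emlIterU j W) x w := by
  rw [dbarCovIterU_eq_gaugeActT_frameAccU, holT_gaugeActT, walkEnd_eq_transl_disp', inv_inv, mul_assoc, mul_assoc, mul_inv_cancel, mul_one,
    mul_inv_cancel_left]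

/-- The `SU(2)` field read in the units of `M₂(ℂ)` is the image under the monoid homomorphism `SU(2) → U(2) → (M₂)ˣ` (`rfl`). [cite: Balaban1985Averaging, (19) p.21] -/
theorem unitsField_toUField_eq_map {j : ℕ} (W : GaugeField P j (Matrix.specialUnitaryGroup (Fin 2) ℂ)) :
    unitsField (toUField W) = fun b => (Unitary.toUnits.comp (suIncl (N := 2))) (W b) := rfl

/-- Transports of the `SU(2)` field read in `(M₂)ˣ` are the images of the `SU(2)` transports (units-level ✓`val_holT_unitsField`). [cite: Balaban1985Averaging, (9) p.19, (19) p.21] -/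
theorem holT_unitsField_toUField_eq_map {j : ℕ} (W : GaugeField P j (Matrix.specialUnitaryGroup (Fin 2) ℂ)) (x : Site P j) (w : List (B7Prop1Explicit.Letter P.d)) :
    holT (unitsField (toUField W)) x w = (Unitary.toUnits.comp (suIncl (N := 2))) (holT W x w) := by
  rw [unitsField_toUField_eq_map, holT_map]

/-- The value of the image of `g ∈ SU(2)` in `(M₂)ˣ` is the matrix of `g`. [cite: Balaban1985Averaging, (19) p.21] -/
theorem coe_map_eq (g : Matrix.specialUnitaryGroup (Fin 2) ℂ) :
    (((Unitary.toUnits.comp (suIncl (N := 2))) g : (Matrix (Fin 2) (Fin 2) ℂ)ˣ) : Matrix (Fin 2) (Fin 2) ℂ) = (g : Matrix (Fin 2) (Fin 2) ℂ) := rfl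

end Framed

/-! ## §3 The T³ member: T5's six tower-closeness rows at a printed-regular pair -/

section T3

variable (F : T3Family) {n K : ℕ}

/-- The chart point read in `(M₂)ˣ`: `U′♭ = e^{A₁}·U₀♭` bondwise (from `U′(b) = e^{A₁(b)}U₀(b)`). [cite: Balaban1985Variational, (44) p.285, (112) p.295] -/
theorem bgUnits_eq_expUnit_mul (U₀ U' : GaugeField (F.P K) 0 (Matrix.specialUnitaryGroup (Fin 2) ℂ)) (A₁ : PBond (F.P K) 0 → Matrix (Fin 2) (Fin 2) ℂ)
    (hU' : ∀ b, ((U' b : Matrix.specialUnitaryGroup (Fin 2) ℂ) : Matrix (Fin 2) (Fin 2) ℂ) = exp (A₁ b) * ((U₀ b : Matrix.specialUnitaryGroup (Fin 2) ℂ) : Matrix (Fin 2) (Fin 2) ℂ)) :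
    bgUnits F K U' = fun b => expUnit (A₁ b) * bgUnits F K U₀ b := by
  funext b
  apply Units.ext
  rw [Units.val_mul, val_expUnit]
  show ((U' b : Matrix.specialUnitaryGroup (Fin 2) ℂ) : Matrix (Fin 2) (Fin 2) ℂ) = exp (A₁ b) * ((U₀ b : Matrix.specialUnitaryGroup (Fin 2) ℂ) : Matrix (Fin 2) (Fin 2) ℂ)
  exact hU' b

/-- At the chart point the exponentials `e^{A₁(b)} = U′(b)U₀(b)⁻¹` are special unitary. [cite: Balaban1985Variational, (44) p.285] -/
theorem coe_expUnit_mem_specialUnitaryGroup_of_chart (U₀ U' : GaugeField (F.P K) 0 (Matrix.specialUnitaryGroup (Fin 2) ℂ)) (A₁ : PBond (F.P K) 0 → Matrix (Fin 2) (Fin 2) ℂ)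
    (hU' : ∀ b, ((U' b : Matrix.specialUnitaryGroup (Fin 2) ℂ) : Matrix (Fin 2) (Fin 2) ℂ) = exp (A₁ b) * ((U₀ b : Matrix.specialUnitaryGroup (Fin 2) ℂ) : Matrix (Fin 2) (Fin 2) ℂ))
    (b : PBond (F.P K) 0) :
    ((expUnit (A₁ b) : (Matrix (Fin 2) (Fin 2) ℂ)ˣ) : Matrix (Fin 2) (Fin 2) ℂ) ∈ Matrix.specialUnitaryGroup (Fin 2) ℂ := by
  have hexp : exp (A₁ b) = ((U' b : Matrix.specialUnitaryGroup (Fin 2) ℂ) : Matrix (Fin 2) (Fin 2) ℂ) * star ((U₀ b : Matrix.specialUnitaryGroup (Fin 2) ℂ) : Matrix (Fin 2) (Fin 2) ℂ) := by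
    have h1 : ((U₀ b : Matrix.specialUnitaryGroup (Fin 2) ℂ) : Matrix (Fin 2) (Fin 2) ℂ) * star ((U₀ b : Matrix.specialUnitaryGroup (Fin 2) ℂ) : Matrix (Fin 2) (Fin 2) ℂ) = 1 :=
      (Matrix.mem_unitaryGroup_iff).1 (Matrix.mem_specialUnitaryGroup_iff.1 (U₀ b).2).1
    rw [hU' b, mul_assoc, h1, mul_one]
  have hstar : star ((U₀ b : Matrix.specialUnitaryGroup (Fin 2) ℂ) : Matrix (Fin 2) (Fin 2) ℂ) ∈ Matrix.specialUnitaryGroup (Fin 2) ℂ := by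
    rw [← Matrix.specialUnitaryGroup.coe_star]; exact (star (U₀ b)).2
  rw [val_expUnit, hexp]
  exact Submonoid.mul_mem _ (U' b).2 hstar

/-- `10⁷L³ε₀ ≤ 1` from the T5 window `10¹²L³ε₀ ≤ 1`. [folklore] -/
theorem window7_of_window12 {ε₀ : ℝ} (hε₀ : 0 < ε₀) (hWε : 10 ^ 12 * (F.L : ℝ) ^ 3 * ε₀ ≤ 1) : 10 ^ 7 * (F.L : ℝ) ^ 3 * ε₀ ≤ 1 := by
  have h1 : (0 : ℝ) ≤ (F.L : ℝ) ^ 3 * ε₀ := by positivity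
  nlinarith

/-- ★★ **THE TWISTED STAIR TRANSPORTERS OF THE TOWER ARE WITHIN `10⁻⁶` OF `1`, INDEX BY INDEX**: at `U₀ ∈ 𝔘_k(ε₀)` (`10¹²L³ε₀ ≤ 1`), chart point `U′ = e^{A₁}U₀` with
`‖A₁‖ < e·η` (`10⁹L²e ≤ 1`), for every level `j < K − n`, coarse site `y` and index `i`: `‖τ_j(y, i) − 1‖ ≤ 10⁻⁶` for the twisted stair transporter
`τ_j(y,i) = tstairU (Ū₀♭ʲ) (D̄_j) y i` of the covariant tower `D̄_j = dbarCovIterU j U₀♭ U′♭` against the background tower — the two towers are bondwise RELATIVELY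
`3(2e + 2700Lε₀)`-close (✓`norm_dbarCovIterU_rel_sub_one_le_of_regPr`), hence absolutely `6(2e + 2700Lε₀)`-close together with their inverses (the background tower is `U1`-valued),
and a stair has `≤ 5L` letters (✓`norm_tstairU_sub_one_le_of_rel`): `60L·6(2e + 2700Lε₀) = 120·Le + 162000·L²ε₀ ≤ 2.82·10⁻⁷`.
[cite: Balaban1985Averaging, (58) p.27, (161)-(163) p.42; Balaban1985Variational, (2) p.278] -/
theorem norm_tstairU_sub_one_le_of_regPr {ε₀ e : ℝ} (hε₀ : 0 < ε₀) (he : 0 < e) (hWe : 10 ^ 9 * (F.L : ℝ) ^ 2 * e ≤ 1) (hWε : 10 ^ 12 * (F.L : ℝ) ^ 3 * ε₀ ≤ 1)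
    (U₀ U' : GaugeField (F.P K) 0 (Matrix.specialUnitaryGroup (Fin 2) ℂ)) (hreg : RegPr F n K ε₀ U₀)
    (A₁ : PBond (F.P K) 0 → Matrix (Fin 2) (Fin 2) ℂ) (hA₁ : ‖A₁‖ < e * eta F n K)
    (hU' : ∀ b, ((U' b : Matrix.specialUnitaryGroup (Fin 2) ℂ) : Matrix (Fin 2) (Fin 2) ℂ) = exp (A₁ b) * ((U₀ b : Matrix.specialUnitaryGroup (Fin 2) ℂ) : Matrix (Fin 2) (Fin 2) ℂ))
    {j : ℕ} (hj : j < K - n) (y : Site (F.P K) (j + 1)) (i : Idx (F.P K)) :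
    ‖((tstairU (emlIterU j (bgUnits F K U₀)) (dbarCovIterU j (bgUnits F K U₀) (bgUnits F K U')) y i : (Matrix (Fin 2) (Fin 2) ℂ)ˣ) : Matrix (Fin 2) (Fin 2) ℂ) - 1‖
      ≤ 1 / 10 ^ 6 := by
  have hd : (F.P K).d = 3 := T3Family.P_d F K
  have hLL : ((F.P K).L : ℝ) = F.L := rfl
  have hL3 : 3 ≤ F.L := by obtain ⟨a, ha⟩ := F.hL.1; have := F.hL.2; omega
  have hL1 : (1 : ℝ) ≤ F.L := by exact_mod_cast (show 1 ≤ F.L by omega)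
  have hε7 : 10 ^ 7 * (F.L : ℝ) ^ 3 * ε₀ ≤ 1 := window7_of_window12 F hε₀ hWε
  have hℓ : ((((F.P K).d + 2) * (F.P K).L : ℕ) : ℝ) = 5 * (F.L : ℝ) := by
    rw [hd, ← hLL]; push_cast; ring
  have hA₁b : ∀ b, ‖A₁ b‖ ≤ e * eta F n K := fun b => (norm_le_pi_norm A₁ b).trans hA₁.le
  have hcfg := bgUnits_eq_expUnit_mul F U₀ U' A₁ hU'
  -- numerics: `r := 3(2e + 2700Lε₀)`, `2ℓ(2r) ≤ 10⁻⁶`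
  set r : ℝ := 3 * (2 * e + 2700 * (F.L : ℝ) * ε₀) with hr
  have hr0 : 0 ≤ r := by positivity
  have he9 : 10 ^ 9 * ((F.L : ℝ) * e) ≤ 1 := by
    have hL12 : (F.L : ℝ) ≤ (F.L : ℝ) ^ 2 := by nlinarith
    have : (F.L : ℝ) * e ≤ (F.L : ℝ) ^ 2 * e := mul_le_mul_of_nonneg_right hL12 he.le
    nlinarith
  have hLε : 10 ^ 12 * ((F.L : ℝ) ^ 2 * ε₀) ≤ 1 := by
    have : (F.L : ℝ) ^ 2 * ε₀ ≤ (F.L : ℝ) ^ 3 * ε₀ := mul_le_mul_of_nonneg_right (pow_le_pow_right₀ hL1 (by norm_num : 2 ≤ 3)) hε₀.le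
    linarith
  have hnum : 2 * ((((F.P K).d + 2) * (F.P K).L : ℕ) : ℝ) * (2 * r) ≤ 1 / 10 ^ 6 := by
    rw [hℓ, hr]
    have e1 : 2 * (5 * (F.L : ℝ)) * (2 * (3 * (2 * e + 2700 * (F.L : ℝ) * ε₀))) = 120 * ((F.L : ℝ) * e) + 162000 * ((F.L : ℝ) ^ 2 * ε₀) := by ring
    rw [e1]; nlinarith
  have hr2 : r ≤ 1 / 2 := by
    have hℓ1 : (1 : ℝ) ≤ 2 * ((((F.P K).d + 2) * (F.P K).L : ℕ) : ℝ) := by rw [hℓ]; linarith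
    nlinarith
  -- the background tower is `U1`-valued, the perturbed tower `r`-close to it relatively
  have hV : ∀ b : PBond (F.P K) j, emlIterU j (bgUnits F K U₀) b ∈ U1 (Matrix (Fin 2) (Fin 2) ℂ) :=
    fun b => emlIterU_bgUnits_mem_U1_of_regPr F hε₀ hε7 hreg hj.le b
  have hrel : ∀ b : PBond (F.P K) j,
      ‖((dbarCovIterU j (bgUnits F K U₀) (bgUnits F K U') b : (Matrix (Fin 2) (Fin 2) ℂ)ˣ) : Matrix (Fin 2) (Fin 2) ℂ) *
          (((emlIterU j (bgUnits F K U₀) b)⁻¹ : (Matrix (Fin 2) (Fin 2) ℂ)ˣ) : Matrix (Fin 2) (Fin 2) ℂ) - 1‖ ≤ r := by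
    intro b
    have h1 := norm_dbarCovIterU_rel_sub_one_le_of_regPr F hε₀ he.le hWe hWε U₀ hreg A₁ hA₁b hj.le b
    rw [← hcfg] at h1
    exact h1
  have h₁ : ∀ b : PBond (F.P K) j,
      ‖((dbarCovIterU j (bgUnits F K U₀) (bgUnits F K U') b : (Matrix (Fin 2) (Fin 2) ℂ)ˣ) : Matrix (Fin 2) (Fin 2) ℂ) -
          ((emlIterU j (bgUnits F K U₀) b : (Matrix (Fin 2) (Fin 2) ℂ)ˣ) : Matrix (Fin 2) (Fin 2) ℂ)‖ ≤ 2 * r :=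
    fun b => (norm_sub_le_of_rel (hV b) (hrel b)).trans (by linarith)
  have h₂ : ∀ b : PBond (F.P K) j,
      ‖(((dbarCovIterU j (bgUnits F K U₀) (bgUnits F K U') b)⁻¹ : (Matrix (Fin 2) (Fin 2) ℂ)ˣ) : Matrix (Fin 2) (Fin 2) ℂ) -
          (((emlIterU j (bgUnits F K U₀) b)⁻¹ : (Matrix (Fin 2) (Fin 2) ℂ)ˣ) : Matrix (Fin 2) (Fin 2) ℂ)‖ ≤ 2 * r :=
    fun b => norm_inv_sub_inv_le_of_rel (hV b) hr2 (hrel b)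
  have hδ0 : 0 ≤ 2 * r := by positivity
  have hℓδ : 2 * ((((F.P K).d + 2) * (F.P K).L : ℕ) : ℝ) * (2 * r) ≤ 1 := hnum.trans (by norm_num)
  exact (norm_tstairU_sub_one_le_of_rel _ _ hδ0 hV h₁ h₂ hℓδ y i).trans hnum

/-- ★★ **ROW `hτ` FROM `RegPr`**: the family `i ↦ τ_j(y, i)` of twisted stair transporters is within `1∕200` of `1` in the sup norm at every level `j < K − n` and coarse site `y`
(index by index `≤ 10⁻⁶`, `norm_tstairU_sub_one_le_of_regPr`). [cite: Balaban1985Averaging, (58) p.27, (161)-(163) p.42; Balaban1985Variational, (2) p.278] -/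
theorem norm_tstairU_tower_sub_one_le_of_regPr {ε₀ e : ℝ} (hε₀ : 0 < ε₀) (he : 0 < e) (hWe : 10 ^ 9 * (F.L : ℝ) ^ 2 * e ≤ 1) (hWε : 10 ^ 12 * (F.L : ℝ) ^ 3 * ε₀ ≤ 1)
    (U₀ U' : GaugeField (F.P K) 0 (Matrix.specialUnitaryGroup (Fin 2) ℂ)) (hreg : RegPr F n K ε₀ U₀)
    (A₁ : PBond (F.P K) 0 → Matrix (Fin 2) (Fin 2) ℂ) (hA₁ : ‖A₁‖ < e * eta F n K)
    (hU' : ∀ b, ((U' b : Matrix.specialUnitaryGroup (Fin 2) ℂ) : Matrix (Fin 2) (Fin 2) ℂ) = exp (A₁ b) * ((U₀ b : Matrix.specialUnitaryGroup (Fin 2) ℂ) : Matrix (Fin 2) (Fin 2) ℂ)) :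
    ∀ (j : ℕ) (y : Site (F.P K) (j + 1)), j < K - n →
      ‖(fun i : Idx (F.P K) => ((tstairU (emlIterU j (bgUnits F K U₀)) (dbarCovIterU j (bgUnits F K U₀) (bgUnits F K U')) y i : (Matrix (Fin 2) (Fin 2) ℂ)ˣ) :
        Matrix (Fin 2) (Fin 2) ℂ)) - 1‖ ≤ 1 / 200 := by
  intro j y hj
  rw [pi_norm_le_iff_of_nonneg (by norm_num)]
  intro i
  rw [Pi.sub_apply, Pi.one_apply]
  exact (norm_tstairU_sub_one_le_of_regPr F hε₀ he hWe hWε U₀ U' hreg A₁ hA₁ hU' hj y i).trans (by norm_num)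

end T3

end Summit.QuantumFields.YangMills.Theorems.Prop7TowerClosenessOfRegPr

end
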